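import Summits.QuantumFields.YangMills.Theorems.BalabanUVNodesN18KingModelRecordWindow
import Summits.QuantumFields.YangMills.Theorems.BalabanUVNodesN15KingModelSharperRate

/-!
# BalabanUVNodes ∕ N18 — KING's (3.73) ∕ (4.42) MULTI-SCALE RUNG AT THE RATE `L^{−(1−σ)γ}` FOR EVERY `σ ∈ ]0,1]`: interpolation in place of
# the geometric mean in n18-b's block-distance dictionary for (3.71) line 1 — every rate exponent `< γ ≤ 1` instead of `≤ ½` — and the
# record-window rung of `…N18KingModelRecordWindow` at that rate (Track A, DAG node N18 = NE5 `T4OutputRate.NE5 EA EB W κ θ C₅` :211;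
# cluster K4; key K3⁷ `SpineGivenEndpointR13SepCoPH`)

Cell `pub-ymgap`, WIDTH SEAT `pub-ymgap-dag-n18-w3` (g0; director-ym №197 ∕ HUMAN RULING D-0149), successor piece to START-LIST §n18 item 3
(LANDED-1 `…N18KingModelRecordWindow` p583713; OFFER A of that line).  Filed `--kind proof --supports stmt-QuantumFields-20544 --as helper`.
THEOREMS ONLY: 0 `def`, 0 `sorry`, standard axioms.  THE MODEL of this file is dag-n15-d's part 48 `…N15KingModelSharperRate` (the same
σ-interpolation for King's Lemma 4.5 on node N15), whose `abs_le_rpow_interp_mul_exp` is imported BY NAME.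

HONEST FRAMING.  A REMARK-sized sharpening of the EXPONENT RANGE of a printed, proved MODEL lemma from the tree's own ingredients; C. King's
`A = 0` scalar model ([King1986]) — NOT Bałaban's outputs `E^{(j)}(X; g, U_k(V))`, NOT the record's functionals; King's printed (3.71) ∕ (3.73)
carry the FULL rate `L^{−γk}` TOGETHER WITH the decay `e^{−δ₀|x−y|}`, which needs Prop. 3.8's argument with exponential weights — the endpoint
`σ → 0` at fixed decay is NOT claimed here; cosmetic for K3 (its consumers need only `θ₅ < 1`); N18 NOT discharged; K3⁷ OPEN, not claimed;
counts UNMOVED (typed 28∕28 · discharged 5∕27, A 5∕28); one finite 𝕋⁴ programme at fixed ε — R4 closes only the conditional finite-𝕋⁴ rung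
`BalabanLadder.UV`; nothing continuum ∕ ℝ⁴ ∕ OS ∕ mass gap ∕ Clay.

THE POINT.  The tree's unconditional multi-scale King rung `…N18KingModelTorus.ne5_kingModel_threeFactor_torus` (n18-a g4) concludes
`NE5 EA EB W κ (L^{−γ∕2}) C₅` — rate exponent `γ∕2 ≤ ½` — ONLY because n18-b's block-distance dictionary for (3.71) line 1
(`King1986.Torus.king_prop38_torus_of_decay` → `king_prop38_torus_blocks` → `minimiser_row_rate`) combines the SUP-rate `(C₁ + C₂)·L^{−γK}`
(`king_prop38_torus`, p. 664) with Theorem 3.3's decay of each minimiser kernel (`minimiser_kernel_decay_blocks`) by the GEOMETRIC MEAN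
`min(ε, Ae^{−δt}) ≤ √(εA)·e^{−(δ∕2)t}` (`CovarianceRate.abs_le_sqrt_mul_exp_half`: «combining our bounds with Theorem 3.3», p. 674).  Replacing it by
`min(ε, Ae^{−δt}) ≤ ε^{1−σ}A^{σ}e^{−σδt}` and re-running the SAME chain:
* §1 `rpow_natPow_sigma` (`((L^K)^{−γ})^{1−σ} = (L^{−(1−σ)γ})^K`) · `king_prop38_torus_of_decay_sigma` · ★ `king_prop38_torus_blocks_sigma` — for `d ≥ 1`, odd
  `L ≥ 2`, `a, m² > 0`, `0 ≤ γ ≤ 1` there are `δ₀, c₀ > 0` (of `d, L, a, m²` ONLY — those of `minimiser_kernel_decay_blocks`) such that for EVERY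
  `σ ∈ [0,1]`, every volume `(d, L, m, K)` with `K ≥ 1`, every `n ≥ 1`, the unit torus, fine points `x′` over `x` and unit sites `b`:
  `|ℋ_{K+n}(x′, b) − ℋ_K(x, b)| ≤ C₅ᵘ^{1−σ}·(2ac₀)^{σ}·(L^{−(1−σ)γ})^K·e^{−σδ₀·|B(x) − b|_{T₁}}` with the `K, n`-FREE sup-rate constant `C₅ᵘ(a, L, d, γ)` of
  `N18KingModel.prop38Const_le_unif` (the uniformisation is done BEFORE interpolating, so no monotonicity of `t ↦ t^{1−σ}` in the constant is needed);
  `minimiser_row_rate_sigma` (any common rate `0 < κ ≤ σδ₀`).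
* §2 ★ `ne5_kingModel_threeFactor_torus_sigma` — for `d ≥ 1`, odd `L > 1`, `a, m² > 0`, `0 ≤ γ ≤ 1`, `0 < σ ≤ 1` there are `κ > 0`, `C₅ ≥ 0`
  (of `d, L, a, m², γ, σ` ONLY) such that for King's ACTUAL (4.42) three-factor graphs on Bałaban's tori — THE BINDER LIST OF
  `ne5_kingModel_threeFactor_torus` VERBATIM (every `n ≥ 1`, scale-indexed unit tori `L·M_j = 2L^{m_j}`, carriers with `scale X ≥ 1` reading run A's fine
  points under run B's, `d X ≤ |B(x_A) − B(y_A)|_{T₁}`, the read-out formulas) — and every window: `NE5 EA EB W κ (L^{−(1−σ)γ}) C₅`; composition =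
  `N18KingModelScales.ne5_of_threeFactorRates_lemma45` at `γ′ := (1−σ)γ ≤ 1` with `hu ∕ hv` ≔ `minimiser_row∕col_decay`, `hdu ∕ hdv` ≔ §1, common rate
  `κ = min(δ₁, δ₂, σδ₃, δ₄₅)`; `σ = ½` is the tree's theorem (up to the constant's shape); `ne5_kingModel_threeFactor_letters_sigma`
  (`0 < L^{−(1−σ)γ}`, and `< 1` iff `γ > 0 ∧ σ < 1`).
* §3 `n18At_kingModel_u3OfRecord₁₃_sigma` — the record-window rung of `…N18KingModelRecordWindow` §3 at rate `L^{−(1−σ)γ}`: EVERY Stage-13 tuple `θ`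
  (window `Window θ.γ`, radius `θ.γ`), EVERY run length, ANY gauge rank; `kingModel_letters_signs_sigma` (the block passes `U3Letters₁₁.Signs` for
  `γ > 0`, `σ < 1`).
NOT COVERED: the sharp endpoint (rate `L^{−γK}` at fixed decay); `j = 0`; (2.20) rescaling; derivative ∕ Hölder lines; Bałaban's `E^{(j)}`.
Sources (the model only): C. King, *The U(1) Higgs model. I. The continuum limit*, Commun. Math. Phys. **102** (1986) 649–677 [King1986] —
Prop. 3.8 (3.71) p. 664, Prop. 3.9 (3.73) p. 665, Thm 3.3 (3.7) p. 658, Prop. 3.7 (3.64) p. 663, Lemma 4.5 (4.38) p. 674, (4.42)–(4.43) p. 675;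
T. Bałaban, Commun. Math. Phys. **109** (1987) 249–301 [Balaban1987RG1] — (0.24)–(0.25) p. 257, Thm 1 p. 259.  No claim about the mass gap.
-/

noncomputable section

namespace Summit.QuantumFields.YangMills.BalabanUVNodes.N18KingModelTorusSigma

open Real Matrix
open Literature.MathematicalPhysics.QuantumFieldTheory.Balaban1983to89 (Params)
open Literature.MathematicalPhysics.QuantumFieldTheory.Balaban1983to89.T4Continuum (T4Family)
open Literature.MathematicalPhysics.QuantumFieldTheory.Balaban1983to89.T4OutputRate (Carriers Functional NE5)
open Literature.MathematicalPhysics.QuantumFieldTheory.Balaban1983to89.B5Prop11Plancherel (Tor fine)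
open Literature.MathematicalPhysics.QuantumFieldTheory.Balaban1983to89.B4Sect5Proof (latticeConst latticeConst_nonneg)
open Literature.MathematicalPhysics.QuantumFieldTheory.King1986 (aK aK_le lemma43Const prop38RateConst prop38PosConst exp_decay_mono)
open Literature.MathematicalPhysics.QuantumFieldTheory.King1986.Torus
  (minimiser effLaplacian blockProj blockOf blockOf_over tdistT tdistT_symm tdistT_nonneg K45 K45_nonneg delta45 gam0L gam0L_pos
    delta45_pos minimiser_row_decay minimiser_col_decay minimiser_kernel_decay_blocks king_prop38_torus sitesPerDir_finerVolume)
open Literature.MathematicalPhysics.QuantumFieldTheory.Balaban1983to89.Node00 (Stage13Params U3Letters₁₁ U3Objects₁₁)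
open Summit.QuantumFields.YangMills.BalabanUVNodes.N18KingModel
  (prop38Const_le_unif prop38Const_unif_nonneg rpow_neg_natPow kingTheta_pos kingTheta_lt_one)
open Summit.QuantumFields.YangMills.BalabanUVNodes.N18KingModelScales (ne5_of_threeFactorRates_lemma45)
open Summit.QuantumFields.YangMills.BalabanUVNodes.N15.KingModel (abs_le_rpow_interp_mul_exp)
open Summit.QuantumFields.YangMills.BalabanUVNodes.N18KingModelRecordWindow (n18At_u3OfRecord₁₃_ofFixed_of_forall_window kingModel_letters_signs)
open YMDAG.UVSplit (N18At u3OfRecord₁₃)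

variable {d : ℕ}

/-! ## §1 (3.71) line 1 in block-distance currency at the interpolated rate `L^{−(1−σ)γ}`, decay `σδ₀` -/

/-- `((L^K)^{−γ})^{1−σ} = (L^{−(1−σ)γ})^K` (real powers of the nonnegative base `L`). [folklore] -/
theorem rpow_natPow_sigma (L K : ℕ) (γ σ : ℝ) :
    (((L ^ K : ℕ) : ℝ) ^ (-γ)) ^ (1 - σ) = ((L : ℝ) ^ (-((1 - σ) * γ))) ^ K := by
  have hL : (0 : ℝ) ≤ L := Nat.cast_nonneg L
  have hθ : (0 : ℝ) ≤ (L : ℝ) ^ (-γ) := Real.rpow_nonneg hL _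
  rw [rpow_neg_natPow, ← Real.rpow_natCast ((L : ℝ) ^ (-γ)) K, ← Real.rpow_mul hθ, mul_comm (K : ℝ) (1 - σ),
    Real.rpow_mul hθ, Real.rpow_natCast, ← Real.rpow_mul hL]
  congr 2
  ring

/-- **(3.71) line 1 COMBINED WITH THEOREM 3.3 BY INTERPOLATION** (the `σ`-twin of n18-b's `King1986.Torus.king_prop38_torus_of_decay`): on the
torus `Π_μ ℤ∕(L·M_μ)`, `k, n ≥ 1`, if BOTH minimiser kernels at the unit site `b` are bounded by `c₀·e^{−δ₀t}` (Theorem 3.3 ∕ Prop. 3.7 at a common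
length `t`), then with the `k, n`-FREE sup-rate constant `C₅ᵘ(a, L, d, γ)` of `N18KingModel.prop38Const_le_unif` and EVERY `σ ∈ [0,1]`:
`|ℋ_{k+n}(x′, b) − ℋ_k(x, b)| ≤ (C₅ᵘ·(L^k)^{−γ})^{1−σ}·(2c₀)^{σ}·e^{−σδ₀t}` — King's sup-rate `king_prop38_torus` (`≤ (C₁(k,n) + C₂)(L^k)^{−γ} ≤ C₅ᵘ(L^k)^{−γ}`)
and `|ℋ′ − ℋ| ≤ |ℋ′| + |ℋ| ≤ 2c₀e^{−δ₀t}` through `abs_le_rpow_interp_mul_exp` (`σ = ½`: the tree's geometric mean).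
[cite: King1986, Prop. 3.8 (3.71) p.664 and p.674] -/
theorem king_prop38_torus_of_decay_sigma (hd : 0 < d) {L : ℕ} [NeZero L] (hLodd : Odd L) (hL : 2 ≤ L) {k n : ℕ}
    (hk : 1 ≤ k) (hn : 1 ≤ n) (M : Fin d → ℕ) [∀ μ, NeZero (M μ)] {a m2 : ℝ} (ha : 0 < a) (hm : 0 < m2)
    {γ : ℝ} (hγ0 : 0 ≤ γ) (hγ1 : γ ≤ 1) {σ : ℝ} (hσ0 : 0 ≤ σ) (hσ1 : σ ≤ 1) (b : Tor M) (x : Tor (fine (L ^ k) M))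
    (x' : Tor (fine (L ^ n * L ^ k) M)) (hx : ∀ μ, (x μ).val = (x' μ).val / L ^ n)
    {c₀ δ₀ t : ℝ}
    (hdecA : |minimiser (L ^ k) M (aK a L k) (((L ^ k : ℕ) : ℝ) ^ 2) m2 (Pi.single b 1) x|
      ≤ c₀ * Real.exp (-(δ₀ * t)))
    (hdecB : |minimiser (L ^ n * L ^ k) M (aK a L (k + n)) (((L ^ n * L ^ k : ℕ) : ℝ) ^ 2) m2 (Pi.single b 1) x'|
      ≤ c₀ * Real.exp (-(δ₀ * t))) :
    |minimiser (L ^ n * L ^ k) M (aK a L (k + n)) (((L ^ n * L ^ k : ℕ) : ℝ) ^ 2) m2 (Pi.single b 1) x'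
        - minimiser (L ^ k) M (aK a L k) (((L ^ k : ℕ) : ℝ) ^ 2) m2 (Pi.single b 1) x|
      ≤ ((prop38RateConst a a (a * (2 * ((a * (1 - ((L : ℝ) ^ 2)⁻¹))⁻¹ + π ^ 2 / 48 + 1 / 3))) ((π ^ 2 / 4) ^ d) d γ
            + prop38PosConst a ((π ^ 2 / 4) ^ d) d γ) * ((L ^ k : ℕ) : ℝ) ^ (-γ)) ^ (1 - σ)
          * (2 * c₀) ^ σ * Real.exp (-(σ * δ₀ * t)) := by
  have hrate := king_prop38_torus hd hLodd hL hk hn M ha hm hγ0 hγ1 b x x' hx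
  have hθK : 0 ≤ ((L ^ k : ℕ) : ℝ) ^ (-γ) := Real.rpow_nonneg (Nat.cast_nonneg _) _
  have hCle := prop38Const_le_unif hd ha hL hk hn (show γ < 2 by linarith)
  have h1 := hrate.trans (mul_le_mul_of_nonneg_right hCle hθK)
  refine abs_le_rpow_interp_mul_exp hσ0 hσ1 h1 ?_
  calc |minimiser (L ^ n * L ^ k) M (aK a L (k + n)) (((L ^ n * L ^ k : ℕ) : ℝ) ^ 2) m2 (Pi.single b 1) x'
          - minimiser (L ^ k) M (aK a L k) (((L ^ k : ℕ) : ℝ) ^ 2) m2 (Pi.single b 1) x|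
      ≤ |minimiser (L ^ n * L ^ k) M (aK a L (k + n)) (((L ^ n * L ^ k : ℕ) : ℝ) ^ 2) m2 (Pi.single b 1) x'|
        + |minimiser (L ^ k) M (aK a L k) (((L ^ k : ℕ) : ℝ) ^ 2) m2 (Pi.single b 1) x| := abs_sub _ _
    _ ≤ c₀ * Real.exp (-(δ₀ * t)) + c₀ * Real.exp (-(δ₀ * t)) := add_le_add hdecB hdecA
    _ = 2 * c₀ * Real.exp (-(δ₀ * t)) := by ring

/-- ★ **KING's (3.71), FIRST LINE, IN BLOCK-DISTANCE CURRENCY AT THE INTERPOLATED RATE — UNCONDITIONAL, CONSTANT UNIFORM IN `K, n`** (the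
`σ`-twin of n18-b's `King1986.Torus.king_prop38_torus_blocks`).  For `d ≥ 1`, odd `L ≥ 2`, `a > 0`, `m² > 0`, `0 ≤ γ ≤ 1` there are `δ₀, c₀ > 0`
(functions of `d, L, a, m²` ONLY — those of `minimiser_kernel_decay_blocks`) such that for EVERY `σ ∈ [0,1]`, every volume `P = (d, L, m, K)` with
`K ≥ 1`, every `n ≥ 1`, the unit torus `M_μ = 2L^m` of `P`, every fine point `x′ ∈ T_{η′}` over `x ∈ T_η` and unit site `b`:
`|ℋ_{K+n}(x′, b) − ℋ_K(x, b)| ≤ C₅ᵘ^{1−σ}·(2ac₀)^{σ}·(L^{−(1−σ)γ})^K·e^{−σδ₀·tdistT M (B(x)) b}`.  Inputs: `minimiser_kernel_decay_blocks` for both runs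
(`blockOf_over`: the two runs see the SAME block; `aK_le`), `king_prop38_torus_of_decay_sigma`, `rpow_natPow_sigma`.
[cite: King1986, Prop. 3.8 (3.71) p.664, Thm 3.3 (3.7) p.658, Prop. 3.7 (3.64) p.663, p.674] -/
theorem king_prop38_torus_blocks_sigma (dd L : ℕ) (hd : 1 ≤ dd) (hLodd : Odd L) (hL : 2 ≤ L) {a m2 : ℝ} (ha : 0 < a)
    (hm : 0 < m2) {γ : ℝ} (hγ0 : 0 ≤ γ) (hγ1 : γ ≤ 1) :
    ∃ δ₀ c₀ : ℝ, 0 < δ₀ ∧ 0 < c₀ ∧ ∀ {σ : ℝ} (_hσ0 : 0 ≤ σ) (_hσ1 : σ ≤ 1) (P : Params) (_hPd : P.d = dd) (_hPL : P.L = L)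
      (_hK : 1 ≤ P.K) [NeZero P.L] (n : ℕ) (_hn : 1 ≤ n) (M : Fin P.d → ℕ) [∀ μ, NeZero (M μ)] (_hMK : ∀ μ, M μ = P.sitesPerDir P.K)
      (xt : Tor (fine (P.L ^ P.K) M)) (xt' : Tor (fine (P.L ^ n * P.L ^ P.K) M)) (bt : Tor M)
      (_hxx : ∀ μ, (xt μ).val = (xt' μ).val / P.L ^ n),
      |minimiser (P.L ^ n * P.L ^ P.K) M (aK a P.L (P.K + n)) (((P.L ^ n * P.L ^ P.K : ℕ) : ℝ) ^ 2) m2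
            (Pi.single bt 1) xt'
          - minimiser (P.L ^ P.K) M (aK a P.L P.K) (((P.L ^ P.K : ℕ) : ℝ) ^ 2) m2 (Pi.single bt 1) xt|
        ≤ (prop38RateConst a a (a * (2 * ((a * (1 - ((P.L : ℝ) ^ 2)⁻¹))⁻¹ + π ^ 2 / 48 + 1 / 3)))
              ((π ^ 2 / 4) ^ P.d) P.d γ + prop38PosConst a ((π ^ 2 / 4) ^ P.d) P.d γ) ^ (1 - σ)
            * (2 * (a * c₀)) ^ σ * ((P.L : ℝ) ^ (-((1 - σ) * γ))) ^ P.K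
            * Real.exp (-(σ * δ₀ * tdistT M (blockOf (P.L ^ P.K) M xt) bt)) := by
  have hL1 : 1 < L := by omega
  obtain ⟨δ₀, c₀, hδ₀, hc₀, H⟩ := minimiser_kernel_decay_blocks dd L hd ⟨hLodd, hL1⟩ ha hm.le
  refine ⟨δ₀, c₀, hδ₀, hc₀, ?_⟩
  intro σ hσ0 hσ1 P hPd hPL hK _ n hn M _ hMK xt xt' bt hxx
  have hLr : (1 : ℝ) < P.L := by exact_mod_cast P.hL.2
  have hPd0 : 0 < P.d := by have := P.hd; omega
  have hPodd : Odd P.L := P.hL.1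
  have hPL2 : 2 ≤ P.L := by have := P.hL.2; omega
  -- run A: volume `P`
  have hA := H P hPd hPL hK M hMK (P.L ^ P.K) rfl xt bt
  have hdecA : |minimiser (P.L ^ P.K) M (aK a P.L P.K) (((P.L ^ P.K : ℕ) : ℝ) ^ 2) m2 (Pi.single bt 1) xt|
      ≤ a * c₀ * Real.exp (-(δ₀ * tdistT M (blockOf (P.L ^ P.K) M xt) bt)) :=
    hA.trans (mul_le_mul_of_nonneg_right (mul_le_mul_of_nonneg_right (aK_le ha hLr hK) hc₀.le)
      (Real.exp_pos _).le)
  -- run B: volume `(d, L, m, K + n)` over the same unit torus, same block under `x′`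
  have hMK' : ∀ μ, M μ = (⟨P.d, P.L, P.m, P.K + n, P.hd, P.hL⟩ : Params).sitesPerDir (P.K + n) := fun μ => by
    rw [hMK μ]; exact (sitesPerDir_finerVolume P n).symm
  have hN : P.L ^ n * P.L ^ P.K = P.L ^ (P.K + n) := by rw [pow_add, mul_comm]
  have hB := H (⟨P.d, P.L, P.m, P.K + n, P.hd, P.hL⟩ : Params) hPd hPL (show 1 ≤ P.K + n by omega) M hMK'
    (P.L ^ n * P.L ^ P.K) hN xt' bt
  rw [blockOf_over M xt xt' hxx] at hB
  have hdecB : |minimiser (P.L ^ n * P.L ^ P.K) M (aK a P.L (P.K + n)) (((P.L ^ n * P.L ^ P.K : ℕ) : ℝ) ^ 2) m2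
        (Pi.single bt 1) xt'| ≤ a * c₀ * Real.exp (-(δ₀ * tdistT M (blockOf (P.L ^ P.K) M xt) bt)) :=
    hB.trans (mul_le_mul_of_nonneg_right (mul_le_mul_of_nonneg_right
      (aK_le ha hLr (show 1 ≤ P.K + n by omega)) hc₀.le) (Real.exp_pos _).le)
  have h := king_prop38_torus_of_decay_sigma hPd0 hPodd hPL2 hK hn M ha hm hγ0 hγ1 hσ0 hσ1 bt xt xt' hxx hdecA hdecB
  -- split the interpolated constant: `(C₅ᵘ·θ_K)^{1−σ} = C₅ᵘ^{1−σ}·(L^{−(1−σ)γ})^K`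
  have hCu : 0 ≤ prop38RateConst a a (a * (2 * ((a * (1 - ((P.L : ℝ) ^ 2)⁻¹))⁻¹ + π ^ 2 / 48 + 1 / 3)))
      ((π ^ 2 / 4) ^ P.d) P.d γ + prop38PosConst a ((π ^ 2 / 4) ^ P.d) P.d γ :=
    prop38Const_unif_nonneg hPd0 ha hPL2 (by linarith)
  have hθK : 0 ≤ ((P.L ^ P.K : ℕ) : ℝ) ^ (-γ) := Real.rpow_nonneg (Nat.cast_nonneg _) _
  rw [Real.mul_rpow hCu hθK, rpow_natPow_sigma] at h
  calc _ ≤ _ := h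
    _ = _ := by ring

/-- **The consumers' read-out shape** (the `σ`-twin of n18-b's `minimiser_row_rate`): the same at ANY common smaller rate `0 < κ ≤ σδ₀`.
[cite: King1986, Prop. 3.8 (3.71) p.664, p.674] -/
theorem minimiser_row_rate_sigma (dd L : ℕ) (hd : 1 ≤ dd) (hLodd : Odd L) (hL : 2 ≤ L) {a m2 : ℝ} (ha : 0 < a)
    (hm : 0 < m2) {γ : ℝ} (hγ0 : 0 ≤ γ) (hγ1 : γ ≤ 1) :
    ∃ δ₀ c₀ : ℝ, 0 < δ₀ ∧ 0 < c₀ ∧ ∀ {σ : ℝ} (_hσ0 : 0 ≤ σ) (_hσ1 : σ ≤ 1) (P : Params) (_hPd : P.d = dd) (_hPL : P.L = L)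
      (_hK : 1 ≤ P.K) [NeZero P.L] (n : ℕ) (_hn : 1 ≤ n) (M : Fin P.d → ℕ) [∀ μ, NeZero (M μ)] (_hMK : ∀ μ, M μ = P.sitesPerDir P.K)
      (κ : ℝ) (_hκ : 0 < κ) (_hκδ : κ ≤ σ * δ₀)
      (xt : Tor (fine (P.L ^ P.K) M)) (xt' : Tor (fine (P.L ^ n * P.L ^ P.K) M)) (bt : Tor M)
      (_hxx : ∀ μ, (xt μ).val = (xt' μ).val / P.L ^ n),
      |minimiser (P.L ^ n * P.L ^ P.K) M (aK a P.L (P.K + n)) (((P.L ^ n * P.L ^ P.K : ℕ) : ℝ) ^ 2) m2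
            (Pi.single bt 1) xt'
          - minimiser (P.L ^ P.K) M (aK a P.L P.K) (((P.L ^ P.K : ℕ) : ℝ) ^ 2) m2 (Pi.single bt 1) xt|
        ≤ (prop38RateConst a a (a * (2 * ((a * (1 - ((P.L : ℝ) ^ 2)⁻¹))⁻¹ + π ^ 2 / 48 + 1 / 3)))
              ((π ^ 2 / 4) ^ P.d) P.d γ + prop38PosConst a ((π ^ 2 / 4) ^ P.d) P.d γ) ^ (1 - σ)
            * (2 * (a * c₀)) ^ σ * ((P.L : ℝ) ^ (-((1 - σ) * γ))) ^ P.K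
            * Real.exp (-(κ * tdistT M (blockOf (P.L ^ P.K) M xt) bt)) := by
  obtain ⟨δ₀, c₀, hδ₀, hc₀, H⟩ := king_prop38_torus_blocks_sigma dd L hd hLodd hL ha hm hγ0 hγ1
  refine ⟨δ₀, c₀, hδ₀, hc₀, ?_⟩
  intro σ hσ0 hσ1 P hPd hPL hK _ n hn M _ hMK κ _ hκδ xt xt' bt hxx
  have hPd0 : 0 < P.d := by have := P.hd; omega
  have hPL2 : 2 ≤ P.L := by have := P.hL.2; omega
  have hC : 0 ≤ (prop38RateConst a a (a * (2 * ((a * (1 - ((P.L : ℝ) ^ 2)⁻¹))⁻¹ + π ^ 2 / 48 + 1 / 3)))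
        ((π ^ 2 / 4) ^ P.d) P.d γ + prop38PosConst a ((π ^ 2 / 4) ^ P.d) P.d γ) ^ (1 - σ)
      * (2 * (a * c₀)) ^ σ * ((P.L : ℝ) ^ (-((1 - σ) * γ))) ^ P.K :=
    mul_nonneg (mul_nonneg (Real.rpow_nonneg (prop38Const_unif_nonneg hPd0 ha hPL2 (by linarith)) _)
      (Real.rpow_nonneg (by positivity) _)) (pow_nonneg (Real.rpow_nonneg (Nat.cast_nonneg _) _) _)
  exact (H hσ0 hσ1 P hPd hPL hK n hn M hMK xt xt' bt hxx).trans
    (exp_decay_mono hC hκδ (tdistT_nonneg M _ _))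

/-! ## §2 (3.73), first bound, `j ≥ 1`, on Bałaban's tori at the rate `L^{−(1−σ)γ}` -/

/-- ★ **KING's (3.73) = (4.42)–(4.43), FIRST BOUND, `j ≥ 1`, MULTI-SCALE, AT THE RATE `L^{−(1−σ)γ}` FOR EVERY `σ ∈ ]0,1]` — UNCONDITIONAL FOR
KING's ACTUAL OPERATORS ON BAŁABAN's TORI.**  For `d ≥ 1`, odd `L > 1`, `a > 0`, `m² > 0`, `0 ≤ γ ≤ 1`, `0 < σ ≤ 1` there are `κ > 0`, `C₅ ≥ 0`
(functions of `d, L, a, m², γ, σ` ONLY) such that — with THE BINDER LIST OF `…N18KingModelTorus.ne5_kingModel_threeFactor_torus` VERBATIM (every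
`n ≥ 1`; every scale-indexed family of unit tori `L·M_j(μ) = 2L^{m_j}`; every carriers `C` with `1 ≤ scale X` reading run A's fine points
`x_A(X), y_A(X)` UNDER run B's `x_B(X), y_B(X)` with `d X ≤ |B(x_A) − B(y_A)|_{T₁}`; every functionals reading King's ACTUAL (4.42) graphs; every
window `W`) — `NE5 EA EB W κ (L^{−(1−σ)γ}) C₅`: ONE rate `θ₅ = L^{−(1−σ)γ}` for ALL scales, EVERY exponent `< γ` reachable (`σ = ½` = the tree's
`L^{−γ∕2}`).  Composition: `N18KingModelScales.ne5_of_threeFactorRates_lemma45` at `γ′ = (1−σ)γ ≤ 1` (middle line: `king_lemma45_torus`,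
`king_cov_decay_torus`, `tdistT_sumBound`) with `hu ∕ hv` ≔ `minimiser_row∕col_decay` (∘ `blockOf_over`), `hdu ∕ hdv` ≔ `minimiser_row_rate_sigma`
(∘ `tdistT_symm`), at `κ = min(δ₀^{row}, δ₀^{col}, σδ₀^{rate}, δ₄₅)`.  `A = 0` MODEL; periodic b.c.; `j = 0`, (2.20)-rescaling, derivative lines outside.
[cite: King1986, Prop. 3.9 (3.73) p.665, (4.42)–(4.43) p.675, Prop. 3.8 (3.71) p.664, Lemma 4.5 (4.38) p.674, Thm 3.3 p.658] -/
theorem ne5_kingModel_threeFactor_torus_sigma (hd : 1 ≤ d) (L : ℕ) [NeZero L] (hLp : Odd L ∧ 1 < L) {a m2 : ℝ}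
    (ha : 0 < a) (hm : 0 < m2) {γ : ℝ} (hγ0 : 0 ≤ γ) (hγ1 : γ ≤ 1) {σ : ℝ} (hσ0 : 0 < σ) (hσ1 : σ ≤ 1) :
    ∃ κ C₅ : ℝ, 0 < κ ∧ 0 ≤ C₅ ∧
      ∀ (n : ℕ) (_hn : 1 ≤ n) (M : ℕ → Fin d → ℕ) [∀ j μ, NeZero (M j μ)]
        (_hM : ∀ j, ∃ mm : ℕ, ∀ μ, L * M j μ = 2 * L ^ mm)
        (C : Carriers) (_hsc : ∀ X, 1 ≤ C.scale X)
        (xA yA : (X : C.Dom) → Tor (fine (L ^ C.scale X) (fine L (M (C.scale X)))))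
        (xB yB : (X : C.Dom) → Tor (fine (L ^ n * L ^ C.scale X) (fine L (M (C.scale X)))))
        (_hx : ∀ X μ, (xA X μ).val = (xB X μ).val / L ^ n)
        (_hy : ∀ X μ, (yA X μ).val = (yB X μ).val / L ^ n)
        (_hd : ∀ X, C.d X ≤ tdistT (fine L (M (C.scale X)))
            (blockOf (L ^ C.scale X) (fine L (M (C.scale X))) (xA X))
            (blockOf (L ^ C.scale X) (fine L (M (C.scale X))) (yA X)))
        (EA : Functional C C.BgA) (EB : Functional C C.BgB)
        (_hEA : ∀ g U X, EA g U X =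
          (fun z => minimiser (L ^ C.scale X) (fine L (M (C.scale X))) (aK a L (C.scale X))
              (((L ^ C.scale X : ℕ) : ℝ) ^ 2) m2 (Pi.single z 1) (xA X))
            ⬝ᵥ ((effLaplacian (L ^ C.scale X) (fine L (M (C.scale X))) (aK a L (C.scale X))
                    (((L ^ C.scale X : ℕ) : ℝ) ^ 2) m2
                  + (a * ((L : ℝ) ^ 2)⁻¹) • blockProj L (M (C.scale X)))⁻¹
                *ᵥ fun w => minimiser (L ^ C.scale X) (fine L (M (C.scale X))) (aK a L (C.scale X))
                    (((L ^ C.scale X : ℕ) : ℝ) ^ 2) m2 (Pi.single w 1) (yA X)))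
        (_hEB : ∀ g U X, EB g U X =
          (fun z => minimiser (L ^ n * L ^ C.scale X) (fine L (M (C.scale X))) (aK a L (C.scale X + n))
              (((L ^ n * L ^ C.scale X : ℕ) : ℝ) ^ 2) m2 (Pi.single z 1) (xB X))
            ⬝ᵥ ((effLaplacian (L ^ n * L ^ C.scale X) (fine L (M (C.scale X))) (aK a L (C.scale X + n))
                    (((L ^ n * L ^ C.scale X : ℕ) : ℝ) ^ 2) m2
                  + (a * ((L : ℝ) ^ 2)⁻¹) • blockProj L (M (C.scale X)))⁻¹
                *ᵥ fun w => minimiser (L ^ n * L ^ C.scale X) (fine L (M (C.scale X))) (aK a L (C.scale X + n))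
                    (((L ^ n * L ^ C.scale X : ℕ) : ℝ) ^ 2) m2 (Pi.single w 1) (yB X)))
        (W : Set (ℕ → ℝ)),
        NE5 EA EB W κ ((L : ℝ) ^ (-((1 - σ) * γ))) C₅ := by
  have hd0 : 0 < d := hd
  have hL2 : 2 ≤ L := by have := hLp.2; omega
  -- the three outer-line packages (Theorem 3.3 for rows ∕ columns; (3.71) line 1 at the interpolated rate), BY NAME
  obtain ⟨δ₁, c₁, hδ₁, hc₁, H₁⟩ := minimiser_row_decay d L hd hLp ha hm.le
  obtain ⟨δ₂, c₂, hδ₂, hc₂, H₂⟩ := minimiser_col_decay d L hd hLp ha hm.le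
  obtain ⟨δ₃, c₃, hδ₃, hc₃, H₃⟩ := minimiser_row_rate_sigma d L hd hLp.1 hL2 ha hm hγ0 hγ1
  -- one common decay rate for the four outer lines and the middle line
  have hδ45 : 0 < delta45 d a L := delta45_pos (d := d) ha hL2
  set κ : ℝ := min (min (min δ₁ δ₂) (σ * δ₃)) (delta45 d a L) with hκ_def
  have hκpos : 0 < κ := lt_min (lt_min (lt_min hδ₁ hδ₂) (mul_pos hσ0 hδ₃)) hδ45
  have hκ₁ : κ ≤ δ₁ := (min_le_left _ _).trans ((min_le_left _ _).trans (min_le_left _ _))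
  have hκ₂ : κ ≤ δ₂ := (min_le_left _ _).trans ((min_le_left _ _).trans (min_le_right _ _))
  have hκ₃ : κ ≤ σ * δ₃ := (min_le_left _ _).trans (min_le_right _ _)
  have hκ45 : κ ≤ delta45 d a L := min_le_right _ _
  -- the uniform letters
  set Cu : ℝ := prop38RateConst a a (a * (2 * ((a * (1 - ((L : ℝ) ^ 2)⁻¹))⁻¹ + π ^ 2 / 48 + 1 / 3)))
      ((π ^ 2 / 4) ^ d) d γ + prop38PosConst a ((π ^ 2 / 4) ^ d) d γ with hCu
  have hCu0 : 0 ≤ Cu := prop38Const_unif_nonneg hd0 ha hL2 (by linarith)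
  set cR : ℝ := Cu ^ (1 - σ) * (2 * (a * c₃)) ^ σ with hcR
  have hcR0 : 0 ≤ cR := mul_nonneg (Real.rpow_nonneg hCu0 _) (Real.rpow_nonneg (by positivity) _)
  have hsA : 0 ≤ a * c₁ := by positivity
  have hsB : 0 ≤ a * c₂ := by positivity
  have hγ₀ : 0 < gam0L d a L := gam0L_pos ha hL2
  have hK45 : 0 ≤ K45 d a L := K45_nonneg a L
  have hKd : 0 ≤ latticeConst d (κ / 2) := latticeConst_nonneg d (half_pos hκpos).le
  refine ⟨κ / 2, (cR * (2 / gam0L d a L) * (a * c₂) + a * c₁ * K45 d a L * (a * c₂)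
      + a * c₁ * (2 / gam0L d a L) * cR) * (latticeConst d (κ / 2)) ^ 2, half_pos hκpos, by positivity, ?_⟩
  intro n hn M _ hM C hsc xA yA xB yB hx hy hdd EA EB hEA hEB W
  have hγ1' : (1 - σ) * γ ≤ 1 := by nlinarith
  refine ne5_of_threeFactorRates_lemma45 (C := C) (EA := EA) (EB := EB) (W := W) L hL2 ha hm hn M hγ1' hsc
    (fun X => blockOf (L ^ C.scale X) (fine L (M (C.scale X))) (xA X))
    (fun X => blockOf (L ^ C.scale X) (fine L (M (C.scale X))) (yA X))
    (fun X z => minimiser (L ^ C.scale X) (fine L (M (C.scale X))) (aK a L (C.scale X))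
      (((L ^ C.scale X : ℕ) : ℝ) ^ 2) m2 (Pi.single z 1) (xA X))
    (fun X z => minimiser (L ^ n * L ^ C.scale X) (fine L (M (C.scale X))) (aK a L (C.scale X + n))
      (((L ^ n * L ^ C.scale X : ℕ) : ℝ) ^ 2) m2 (Pi.single z 1) (xB X))
    (fun X w => minimiser (L ^ C.scale X) (fine L (M (C.scale X))) (aK a L (C.scale X))
      (((L ^ C.scale X : ℕ) : ℝ) ^ 2) m2 (Pi.single w 1) (yA X))
    (fun X w => minimiser (L ^ n * L ^ C.scale X) (fine L (M (C.scale X))) (aK a L (C.scale X + n))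
      (((L ^ n * L ^ C.scale X : ℕ) : ℝ) ^ 2) m2 (Pi.single w 1) (yB X))
    (fun X => (effLaplacian (L ^ C.scale X) (fine L (M (C.scale X))) (aK a L (C.scale X))
        (((L ^ C.scale X : ℕ) : ℝ) ^ 2) m2 + (a * ((L : ℝ) ^ 2)⁻¹) • blockProj L (M (C.scale X)))⁻¹)
    (fun X => (effLaplacian (L ^ n * L ^ C.scale X) (fine L (M (C.scale X))) (aK a L (C.scale X + n))
        (((L ^ n * L ^ C.scale X : ℕ) : ℝ) ^ 2) m2 + (a * ((L : ℝ) ^ 2)⁻¹) • blockProj L (M (C.scale X)))⁻¹)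
    (fun _ => rfl) (fun _ => rfl) hκpos hκ45 hsA hsB hcR0 hcR0 ?_ ?_ ?_ ?_ hdd hEA hEB
  · -- `hu`: run A's row, Theorem 3.3 in block-distance currency (`minimiser_row_decay`, volume `(d, L, m_j, j)`)
    intro X z
    obtain ⟨mm, hmm⟩ := hM (C.scale X)
    have hMK : ∀ μ, fine L (M (C.scale X)) μ
        = (⟨d, L, mm, C.scale X, hd, hLp⟩ : Params).sitesPerDir (C.scale X) := fun μ => by
      simp only [Params.sitesPerDir, Nat.add_sub_cancel]; exact hmm μ
    exact H₁ ⟨d, L, mm, C.scale X, hd, hLp⟩ rfl rfl (hsc X) (fine L (M (C.scale X))) hMK (L ^ C.scale X) rfl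
      κ hκpos hκ₁ (xA X) z
  · -- `hv`: run B's column (`minimiser_col_decay`, volume `(d, L, m_j, j + n)`), the block under `y_B` is `B(y_A)`
    intro X w
    obtain ⟨mm, hmm⟩ := hM (C.scale X)
    have hMK : ∀ μ, fine L (M (C.scale X)) μ
        = (⟨d, L, mm, C.scale X + n, hd, hLp⟩ : Params).sitesPerDir (C.scale X + n) := fun μ => by
      simp only [Params.sitesPerDir, Nat.add_sub_cancel]; exact hmm μ
    have hN : L ^ n * L ^ C.scale X = L ^ (C.scale X + n) := by rw [pow_add, mul_comm]
    have h := H₂ ⟨d, L, mm, C.scale X + n, hd, hLp⟩ rfl rfl (show 1 ≤ C.scale X + n by have := hsc X; omega)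
      (fine L (M (C.scale X))) hMK (L ^ n * L ^ C.scale X) hN κ hκpos hκ₂ (yB X) w
    rw [blockOf_over (fine L (M (C.scale X))) (yA X) (yB X) (hy X)] at h
    exact h
  · -- `hdu`: the row difference, (3.71) line 1 at the interpolated rate (`minimiser_row_rate_sigma`)
    intro X z
    obtain ⟨mm, hmm⟩ := hM (C.scale X)
    have hMK : ∀ μ, fine L (M (C.scale X)) μ
        = (⟨d, L, mm, C.scale X, hd, hLp⟩ : Params).sitesPerDir (C.scale X) := fun μ => by
      simp only [Params.sitesPerDir, Nat.add_sub_cancel]; exact hmm μ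
    haveI : NeZero (⟨d, L, mm, C.scale X, hd, hLp⟩ : Params).L := ‹NeZero L›
    exact H₃ hσ0.le hσ1 ⟨d, L, mm, C.scale X, hd, hLp⟩ rfl rfl (hsc X) n hn (fine L (M (C.scale X))) hMK κ hκpos hκ₃
      (xA X) (xB X) z (hx X)
  · -- `hdv`: the column difference, by symmetry of the torus distance
    intro X w
    obtain ⟨mm, hmm⟩ := hM (C.scale X)
    have hMK : ∀ μ, fine L (M (C.scale X)) μ
        = (⟨d, L, mm, C.scale X, hd, hLp⟩ : Params).sitesPerDir (C.scale X) := fun μ => by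
      simp only [Params.sitesPerDir, Nat.add_sub_cancel]; exact hmm μ
    haveI : NeZero (⟨d, L, mm, C.scale X, hd, hLp⟩ : Params).L := ‹NeZero L›
    have h := H₃ hσ0.le hσ1 ⟨d, L, mm, C.scale X, hd, hLp⟩ rfl rfl (hsc X) n hn (fine L (M (C.scale X))) hMK κ hκpos hκ₃
      (yA X) (yB X) w (hy X)
    rw [tdistT_symm (fine L (M (C.scale X))) w]
    exact h

/-- The letters of §2 have CONTENT: `κ > 0` is delivered, `0 < L^{−(1−σ)γ}`, and `L^{−(1−σ)γ} < 1` as soon as `γ > 0` and `σ < 1` (`L ≥ 2`).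
[cite: King1986, Prop. 3.9 (3.73) p.665] -/
theorem ne5_kingModel_threeFactor_letters_sigma {L : ℕ} (hL : 2 ≤ L) {γ σ : ℝ} (hγ : 0 < γ) (hσ : σ < 1) :
    0 < (L : ℝ) ^ (-((1 - σ) * γ)) ∧ (L : ℝ) ^ (-((1 - σ) * γ)) < 1 :=
  ⟨kingTheta_pos (by omega) _, kingTheta_lt_one hL (mul_pos (by linarith) hγ)⟩

/-! ## §3 The record-window rung at the rate `L^{−(1−σ)γ}` -/

/-- **KING's MODEL INHABITS THE N18 SLOT OF THE ₁₃ BUNDLE OF RECORD AT THE RATE `L^{−(1−σ)γ}`** (`…N18KingModelRecordWindow.n18At_kingModel_u3OfRecord₁₃`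
at the interpolated rate): with §2's `κ > 0`, `C₅ ≥ 0` (of `d, L, a, m², γ, σ` only), for every King datum as in §2, EVERY gauge rank, EVERY Stage-13
tuple `θ` (window `Window θ.γ`, radius `θ.γ`), EVERY run length `k` and ANY remaining letters:
`N18At (u3OfRecord₁₃ θ (ofFixed C EA (fun _ => EB) ⟨κ, L^{−(1−σ)γ}, C₅, C₉, ω, cr, ρ⟩) k)`.  `A = 0` MODEL; NOT the record's functionals.
[cite: King1986, Prop. 3.9 (3.73) p.665 and (4.42)-(4.43) p.675; Balaban1987RG1, Thm 1 p.259] -/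
theorem n18At_kingModel_u3OfRecord₁₃_sigma (hd : 1 ≤ d) (L : ℕ) [NeZero L] (hLp : Odd L ∧ 1 < L) {a m2 : ℝ}
    (ha : 0 < a) (hm : 0 < m2) {γ : ℝ} (hγ0 : 0 ≤ γ) (hγ1 : γ ≤ 1) {σ : ℝ} (hσ0 : 0 < σ) (hσ1 : σ ≤ 1) :
    ∃ κ C₅ : ℝ, 0 < κ ∧ 0 ≤ C₅ ∧
      ∀ (n : ℕ) (_hn : 1 ≤ n) (M : ℕ → Fin d → ℕ) [∀ j μ, NeZero (M j μ)]
        (_hM : ∀ j, ∃ mm : ℕ, ∀ μ, L * M j μ = 2 * L ^ mm)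
        (C : Carriers) (_hsc : ∀ X, 1 ≤ C.scale X)
        (xA yA : (X : C.Dom) → Tor (fine (L ^ C.scale X) (fine L (M (C.scale X)))))
        (xB yB : (X : C.Dom) → Tor (fine (L ^ n * L ^ C.scale X) (fine L (M (C.scale X)))))
        (_hx : ∀ X μ, (xA X μ).val = (xB X μ).val / L ^ n)
        (_hy : ∀ X μ, (yA X μ).val = (yB X μ).val / L ^ n)
        (_hd : ∀ X, C.d X ≤ tdistT (fine L (M (C.scale X)))
            (blockOf (L ^ C.scale X) (fine L (M (C.scale X))) (xA X))
            (blockOf (L ^ C.scale X) (fine L (M (C.scale X))) (yA X)))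
        (EA : Functional C C.BgA) (EB : Functional C C.BgB)
        (_hEA : ∀ g U X, EA g U X =
          (fun z => minimiser (L ^ C.scale X) (fine L (M (C.scale X))) (aK a L (C.scale X))
              (((L ^ C.scale X : ℕ) : ℝ) ^ 2) m2 (Pi.single z 1) (xA X))
            ⬝ᵥ ((effLaplacian (L ^ C.scale X) (fine L (M (C.scale X))) (aK a L (C.scale X))
                    (((L ^ C.scale X : ℕ) : ℝ) ^ 2) m2
                  + (a * ((L : ℝ) ^ 2)⁻¹) • blockProj L (M (C.scale X)))⁻¹
                *ᵥ fun w => minimiser (L ^ C.scale X) (fine L (M (C.scale X))) (aK a L (C.scale X))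
                    (((L ^ C.scale X : ℕ) : ℝ) ^ 2) m2 (Pi.single w 1) (yA X)))
        (_hEB : ∀ g U X, EB g U X =
          (fun z => minimiser (L ^ n * L ^ C.scale X) (fine L (M (C.scale X))) (aK a L (C.scale X + n))
              (((L ^ n * L ^ C.scale X : ℕ) : ℝ) ^ 2) m2 (Pi.single z 1) (xB X))
            ⬝ᵥ ((effLaplacian (L ^ n * L ^ C.scale X) (fine L (M (C.scale X))) (aK a L (C.scale X + n))
                    (((L ^ n * L ^ C.scale X : ℕ) : ℝ) ^ 2) m2
                  + (a * ((L : ℝ) ^ 2)⁻¹) • blockProj L (M (C.scale X)))⁻¹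
                *ᵥ fun w => minimiser (L ^ n * L ^ C.scale X) (fine L (M (C.scale X))) (aK a L (C.scale X + n))
                    (((L ^ n * L ^ C.scale X : ℕ) : ℝ) ^ 2) m2 (Pi.single w 1) (yB X)))
        {N : ℕ} [NeZero N] {F : T4Family} (θ : Stage13Params F N) (k : ℕ) (C₉ ω cr ρ : ℝ),
        N18At (u3OfRecord₁₃ θ
          (U3Objects₁₁.ofFixed C EA (fun _ => EB) ⟨κ, (L : ℝ) ^ (-((1 - σ) * γ)), C₅, C₉, ω, cr, ρ⟩) k) := by
  obtain ⟨κ, C₅, hκ, hC₅, H⟩ := ne5_kingModel_threeFactor_torus_sigma hd L hLp ha hm hγ0 hγ1 hσ0 hσ1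
  refine ⟨κ, C₅, hκ, hC₅, ?_⟩
  intro n hn M _ hM C hsc xA yA xB yB hx hy hdd EA EB hEA hEB N _ F θ k C₉ ω cr ρ
  exact n18At_u3OfRecord₁₃_ofFixed_of_forall_window (C := C) (EA := EA) (EB := fun _ => EB)
    (ℓ := ⟨κ, (L : ℝ) ^ (-((1 - σ) * γ)), C₅, C₉, ω, cr, ρ⟩)
    (fun W _ _ => H n hn M hM C hsc xA yA xB yB hx hy hdd EA EB hEA hEB W) θ k

/-- **THE `σ`-RUNG's LETTERS PASS `U3Letters₁₁.Signs`** (`γ > 0`, `σ < 1`, `L ≥ 2`): `⟨κ, L^{−(1−σ)γ}, C₅, C₉, ω, cr, ρ⟩` with `κ > 0`, `C₅ ≥ 0`,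
`0 ≤ C₉`, `0 ≤ ω`, `0 ≤ cr`, `max(L^{−(1−σ)γ}, ω) ≤ ρ < 1` has the signs (`…N18KingModelRecordWindow.kingModel_letters_signs` at `γ ↦ 2(1−σ)γ`).
[cite: King1986, Prop. 3.9 (3.73) p.665; Balaban1987RG1, (1.20)-(1.22) p.264] -/
theorem kingModel_letters_signs_sigma {L : ℕ} (hL : 2 ≤ L) {γ σ : ℝ} (hγ : 0 < γ) (hσ : σ < 1) {κ C₅ C₉ ω cr ρ : ℝ}
    (hκ : 0 < κ) (hC₅ : 0 ≤ C₅) (hC₉ : 0 ≤ C₉) (hω0 : 0 ≤ ω) (hcr : 0 ≤ cr) (hθρ : (L : ℝ) ^ (-((1 - σ) * γ)) ≤ ρ)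
    (hωρ : ω ≤ ρ) (hρ : ρ < 1) :
    (⟨κ, (L : ℝ) ^ (-((1 - σ) * γ)), C₅, C₉, ω, cr, ρ⟩ : U3Letters₁₁).Signs := by
  have h2 : -((1 - σ) * γ) = -((2 * ((1 - σ) * γ)) / 2) := by ring
  rw [h2] at hθρ ⊢
  exact kingModel_letters_signs hL (mul_pos two_pos (mul_pos (by linarith) hγ)) hκ hC₅ hC₉ hω0 hcr hθρ hωρ hρ

end Summit.QuantumFields.YangMills.BalabanUVNodes.N18KingModelTorusSigma

end
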